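import Summits.Ventures.DiscreteObjects.Hadamard.ConferenceGraph333FixedSubgraph

/-!
# An automorphism of order 166 of srg(333,166,82,83) fixes exactly one vertex and has two regular orbits of length 166
# — the BICIRCULANT (two circulant cores of order 166) family for C(334) (kernel)

Framing: lottery ticket; floor = certified bounds/negative ranges.  Cell pub-namedobj (venture DiscreteObjects),
target (H) = `H(668)`, hadamard gen 30.  The largest admissible element order of Aut(srg(333,166,82,83)) in the census is
`166` (gens 29–30, script level).  This file pins its cycle type in the kernel:
* **`aut_order166_structure`** — if `σ^166 = 1`, `σ^83 ≠ 1`, `σ² ≠ 1` (order exactly `166`) then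
  `#Fix σ = #Fix σ² = #Fix σ^83 = 1`: every non-trivial power of `σ` fixes exactly ONE vertex `∞`, i.e. `⟨σ⟩ ≅ ℤ/166`
  acts semiregularly on the other `332` vertices with two orbits `X, Y` of length `166` (census kit of gen 29 +
  order-83 window `f = 1` + parity of the number of `83`-cycles + the involution window).
So an `srg(333,166,82,83)` with an automorphism of order `166` is exactly a BICIRCULANT conference graph: `∞` joined to
one orbit `X` (its `166` neighbours form a union of `⟨σ⟩`-orbits — `aut_order166_nbhd` : `N(∞)` is `σ`-invariant), the
blocks `X×X`, `Y×Y`, `X×Y` circulant over `ℤ/166`; equivalently (E2 words, pub-namedobj-hadamard-g30/FAMILY-Z166.md) a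
symmetric `C(334)` WITH TWO CIRCULANT CORES of order `166`: a cored symmetric `{0,±1}`-sequence `s` (`s(0) = 0`, `Σ s = 1`)
and a `±1`-sequence `t` (`Σ t = 0`) of length `166` with `PAF_s(d) + PAF_t(d) = −2` for all `d ≠ 0` — the even-length,
cored analogue of a Legendre pair; every Paley graph `P(q)`, `q` prime, is of this form over `ℤ/((q−1)/2)`.  A concrete
lottery family for `C(334) ⇒ H(668)` (no finite formulation in print for `ℓ = 166`).
WORDS: structure of a HYPOTHETICAL object; ours (PROVISIONAL).  No `sorry`, no new definitions.
-/

namespace Summit.Ventures.DiscreteObjects.Hadamard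

open Finset

section order166
variable {V : Type*} [Fintype V] [DecidableEq V]

/-- **Order 166 ⇒ one fixed vertex, two regular orbits of length 166.**  For `σ` of order exactly `166`:
`#Fix σ = 1`, `#Fix σ² = 1`, `#Fix σ^83 = 1`. -/
theorem aut_order166_structure (hV : Fintype.card V = 333) (A : Matrix V V ℤ)
    (h01 : ∀ x y, A x y = 0 ∨ A x y = 1) (hsymm : ∀ x y, A y x = A x y) (hdiag : ∀ x, A x x = 0)
    (hk : ∀ x, ∑ y, A x y = 166) (hsrg : ∀ x y, ∑ z, A x z * A z y = 83 * (1 + (if x = y then 1 else 0)) - A x y)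
    (σ : Equiv.Perm V) (hσ : σ ^ 166 = 1) (hσ83 : σ ^ 83 ≠ 1) (hσ2 : σ ^ 2 ≠ 1) (hA : ∀ x y, A (σ x) (σ y) = A x y) :
    (univ.filter fun x => σ x = x).card = 1 ∧ (univ.filter fun x => (σ ^ 2) x = x).card = 1 ∧
      (univ.filter fun x => (σ ^ 83) x = x).card = 1 := by
  have hAk := adj_pow_invariant A σ hA
  obtain ⟨c, h1, h2, -, -, h6⟩ := aut_cycle_length_census hV A h01 hsymm hdiag hk hsrg σ hσ (by norm_num) hA
  have hD : Nat.divisors 166 = {1, 2, 83, 166} := by decide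
  have f1 := h2 1
  have f2 := h2 2
  have f83 := h2 83
  have f166 := h2 166
  have e166 := h6 166 (by norm_num)
  rw [pow_one] at f1
  simp only [hD, Finset.sum_filter] at h1 f1 f2 f83 f166
  norm_num at h1 f1 f2 f83 f166
  -- order-83 power: exactly one fixed point
  have hp2 : (σ ^ 2) ^ 83 = 1 := by rw [← pow_mul]; exact hσ
  obtain ⟨-, -, -, -, -, -, -, -, -, w2⟩ :=
    aut_prime_windows_fs hV A h01 hsymm hdiag hk hsrg (by norm_num : Nat.Prime 83) (by norm_num) (σ ^ 2) hp2 hσ2 (hAk 2)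
  have hw2 := w2 rfl
  rw [f2] at hw2
  -- the involution σ^83 is not the identity: its fixed set is not everything
  have h83lt : (univ.filter fun x => (σ ^ 83) x = x).card < 333 := by
    rw [← hV, ← Finset.card_univ]
    apply Finset.card_lt_card
    rw [Finset.ssubset_univ_iff]
    intro hall
    apply hσ83
    ext x
    have := (Finset.mem_filter.mp (hall ▸ Finset.mem_univ x)).2
    simpa using this
  rw [f83] at h83lt
  -- parity of the fixed-point count of σ (37 ∤ 166)
  obtain ⟨-, hodd⟩ := aut_card_fixed_odd hV A h01 hsymm hdiag hk hsrg σ hσ (by norm_num) hA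
  rw [f1] at hodd
  refine ⟨?_, ?_, ?_⟩
  · rw [f1]; omega
  · rw [f2]; omega
  · rw [f83]; omega

omit [Fintype V] [DecidableEq V] in
/-- **The neighbourhood of the fixed vertex is a union of orbits.**  If `σ ∞ = ∞` then `N(∞)` is `σ`-invariant. -/
theorem aut_fixed_nbhd_invariant (A : Matrix V V ℤ) (σ : Equiv.Perm V) (hA : ∀ x y, A (σ x) (σ y) = A x y)
    {x : V} (hx : σ x = x) (y : V) : A x (σ y) = A x y := by
  conv_lhs => rw [← hx]
  exact hA x y

end order166

end Summit.Ventures.DiscreteObjects.Hadamard
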